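import Summits.AtomisticToContinuum.HydrodynamicLimit.Theorems.JParityClosureParityBandClosureWindowCovarianceIsotropyF
import HarnessLib

/-!
# Window covariance isotropy (crux `JParityClosure.ParityBandClosure`, stmt-AtomisticToContinuum-17608, line
# `transfer-weighted-parity-chain`, stub `stub_windowCovarianceIsotropy`) — helper G: sup bounds of the window
# functionals

WHAT.  §1 Uniform bounds along a hard-sphere trajectory (finitely many collisions in `[0, τ]`, velocities bounded by
the energy): of law-type window functionals (`abs_lawFun_le`), of the Metropolis-odd and marked collision functionals
(`abs_KwO_le`, `abs_KwR_le`, through `abs_collisionPairSum_le`), of the two-time functional (`abs_BwW_le`).  The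
integration OVER the windows is helper H.

REFERENCES.  Elementary measure theory (Mathlib `integral_integral_swap`); H. Spohn (1991), Part I §3.  No named fact.
-/

noncomputable section

namespace Summit.AtomisticToContinuum.HydrodynamicLimit.Theorems.ParityBandClosureWindowCovariance

open scoped BigOperators Topology Classical MeasureTheory ENNReal InnerProductSpace
open Filter Set MeasureTheory Function Topology
open Literature.MathematicalPhysics.KineticTheory
open Literature.Analysis.FluidPDE
open Summit.AtomisticToContinuum.HydrodynamicLimit.Theorems.LocalSecondLawNegative (cone cone_nonneg cone_le
  continuous_cone integral_cone_le)

variable {N : ℕ}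

/-! ## §1 Sup bounds -/

section Bounds

variable {ε r τ t₀ : ℝ} {x₀ : T3} {γ : ℝ → Config (N + 1) (Fin 3) T3}

/-- `|Σ g| ≤ K · Σ 1` on a collision pair sum whose summand is bounded by `K` on the contact triples. [folklore] -/
theorem abs_collisionPairSum_le {d : Type*} [Fintype d] {X : Type*} {n : ℕ} {G : Geometry d X} {ε : ℝ}
    {γ : ℝ → Config n d X} {S : Set ℝ} (hfin : (collisionTimes G ε γ ∩ S).Finite) {g : ℝ → Fin n → Fin n → ℝ}
    {K : ℝ} (h : ∀ t ∈ collisionTimes G ε γ ∩ S, ∀ p ∈ contactPairs G ε (γ t), |g t p.1 p.2| ≤ K) :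
    |collisionPairSum G ε γ S g| ≤ K * collisionPairSum G ε γ S fun _ _ _ => (1 : ℝ) := by
  rw [← collisionPairSum_const_mul hfin, abs_le]
  refine ⟨?_, collisionPairSum_mono hfin fun t ht p hp => by rw [mul_one]; exact (abs_le.1 (h t ht p hp)).2⟩
  have hm := collisionPairSum_mono hfin (g := fun t i j => (-K) * 1) (g' := g)
    fun t ht p hp => by rw [mul_one]; exact (abs_le.1 (h t ht p hp)).1
  rw [collisionPairSum_const_mul hfin] at hm
  rw [collisionPairSum_const_mul hfin]
  linarith

/-- The cone-weighted mean of marks bounded along a configuration is bounded by `3/(πr³) · C`. [folklore] -/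
theorem abs_mean_cone_mul_le' (hr : 0 < r) (x₀ : T3) (w : Config (N + 1) (Fin 3) T3) {ψ : V3 → ℝ} {C : ℝ}
    (hC : ∀ k, |ψ (w k).2| ≤ C) :
    |((N + 1 : ℕ) : ℝ)⁻¹ * ∑ k, cone r (w k).1 x₀ * ψ (w k).2| ≤ 3 / (Real.pi * r ^ 3) * C := by
  rw [abs_mul, abs_of_nonneg (by positivity : (0 : ℝ) ≤ ((N + 1 : ℕ) : ℝ)⁻¹)]
  have h1 : |∑ k, cone r (w k).1 x₀ * ψ (w k).2| ≤ ∑ _k : Fin (N + 1), 3 / (Real.pi * r ^ 3) * C := by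
    refine (Finset.abs_sum_le_sum_abs _ _).trans (Finset.sum_le_sum fun k _ => ?_)
    rw [abs_mul, abs_of_nonneg (cone_nonneg hr _ _)]
    exact mul_le_mul (cone_le_peak hr _ _) (hC k) (abs_nonneg _) (by positivity)
  refine (mul_le_mul_of_nonneg_left h1 (by positivity)).trans ?_
  rw [Finset.sum_const, Finset.card_univ, Fintype.card_fin, nsmul_eq_mul, ← mul_assoc,
    inv_mul_cancel₀ (by positivity), one_mul]

/-- **Sup bound of a law-type window functional**: `|∫ btent ∫ cone ψ dμ ds| ≤ τ · r⁻² · 3/(πr³) · C` when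
`|ψ(vₖ(s))| ≤ C` along the path (`0 ≤ τ`). [folklore] -/
theorem abs_lawFun_le (hr : 0 < r) (hτ : 0 ≤ τ) {ψ : V3 → ℝ} {C : ℝ} (hC : ∀ s k, |ψ (γ s k).2| ≤ C) :
    |∫ s in Set.Icc (0 : ℝ) τ, btent r (s - t₀) * ∫ q, cone r q.1 x₀ * ψ q.2 ∂(empiricalMeasure (γ s))| ≤
      τ * ((r ^ 2)⁻¹ * (3 / (Real.pi * r ^ 3) * C)) := by
  have hC0 : 0 ≤ C := (abs_nonneg _).trans (hC 0 0)
  have hb : ∀ s ∈ Set.Icc (0 : ℝ) τ, ‖btent r (s - t₀) * ∫ q, cone r q.1 x₀ * ψ q.2 ∂(empiricalMeasure (γ s))‖ ≤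
      (r ^ 2)⁻¹ * (3 / (Real.pi * r ^ 3) * C) := by
    intro s _
    rw [norm_mul, Real.norm_eq_abs, Real.norm_eq_abs, abs_of_nonneg (btent_nonneg _ _), integral_empiricalMeasure]
    exact mul_le_mul (btent_le _ _) (abs_mean_cone_mul_le' hr x₀ (γ s) (hC s)) (abs_nonneg _) (by positivity)
  have h := norm_setIntegral_le_of_norm_le_const (s := Set.Icc (0 : ℝ) τ)
    (by rw [Real.volume_Icc]; exact ENNReal.ofReal_lt_top) hb
  rw [Real.norm_eq_abs, measureReal_def, Real.volume_Icc, ENNReal.toReal_ofReal (by linarith), sub_zero,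
    mul_comm] at h
  exact h

/-- `0 ≤ ρ_w ≤ τ r⁻² 3/(πr³)`. [folklore] -/
theorem rhoW_le (hr : 0 < r) (hτ : 0 ≤ τ) : rhoW r τ γ t₀ x₀ ≤ τ * ((r ^ 2)⁻¹ * (3 / (Real.pi * r ^ 3) * 1)) := by
  have h := abs_lawFun_le (t₀ := t₀) (x₀ := x₀) (γ := γ) hr hτ (ψ := fun _ => (1 : ℝ)) (C := 1) (fun s k => by simp)
  simp only [mul_one] at h
  unfold rhoW
  exact (le_abs_self _).trans (by simpa only [mul_one] using h)

/-- **Sup bound of the Metropolis-odd window functional** (`|min(1, eˣ)| ≤ 1`). [folklore] -/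
theorem abs_KwO_le (hγ : IsHardSphereTrajectory (Torus.geometry (Fin 3)) ε (N + 1) γ) (hε : 0 ≤ ε) (hr : 0 < r)
    (ϑ : ℝ) {Ψ : V3 × V3 × V3 → ℝ} {C : ℝ} (hC : ∀ p, |Ψ p| ≤ C) :
    |KwO ε r τ ϑ Ψ γ t₀ x₀| ≤ (r ^ 2)⁻¹ * (3 / (Real.pi * r ^ 3)) * C *
      (ε / (N + 1 : ℝ) * collisionPairSum (Torus.geometry (Fin 3)) ε γ (Set.Icc 0 τ) fun _ _ _ => (1 : ℝ)) := by
  have hfin := finite_collisionTimes_Icc hγ τ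
  have hC0 : 0 ≤ C := (abs_nonneg _).trans (hC 0)
  rw [KwO_eq hγ, abs_mul, abs_of_nonneg (div_nonneg hε (by positivity))]
  have h := abs_collisionPairSum_le hfin (K := (r ^ 2)⁻¹ * (3 / (Real.pi * r ^ 3)) * C) (g := fun s i j =>
      btent r (s - t₀) * cone r (γ s i).1 x₀ *
        (Ψ (ε⁻¹ • (Torus.geometry (Fin 3)).sepVec (γ s i).1 (γ s j).1, (pvW (γ s) i j).1, (pvW (γ s) i j).2) *
          min 1 (Real.exp (-(Real.log (hwW r τ ϑ γ t₀ x₀ (pvW (γ s) i j).1) +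
            Real.log (hwW r τ ϑ γ t₀ x₀ (pvW (γ s) i j).2) -
            Real.log (hwW r τ ϑ γ t₀ x₀ (γ s i).2) - Real.log (hwW r τ ϑ γ t₀ x₀ (γ s j).2))))))
    fun t _ p _ => by
      rw [abs_mul, abs_mul, abs_mul, abs_of_nonneg (btent_nonneg _ _), abs_of_nonneg (cone_nonneg hr _ _)]
      have hmin : |min 1 (Real.exp (-(Real.log (hwW r τ ϑ γ t₀ x₀ (pvW (γ t) p.1 p.2).1) +
          Real.log (hwW r τ ϑ γ t₀ x₀ (pvW (γ t) p.1 p.2).2) -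
          Real.log (hwW r τ ϑ γ t₀ x₀ (γ t p.1).2) - Real.log (hwW r τ ϑ γ t₀ x₀ (γ t p.2).2))))| ≤ 1 := by
        rw [abs_of_nonneg (le_min zero_le_one (Real.exp_nonneg _))]
        exact min_le_left _ _
      calc btent r (t - t₀) * cone r (γ t p.1).1 x₀ * (|Ψ _| * |min 1 _|)
          ≤ (r ^ 2)⁻¹ * (3 / (Real.pi * r ^ 3)) * (C * 1) :=
            mul_le_mul (mul_le_mul (btent_le _ _) (cone_le_peak hr _ _) (cone_nonneg hr _ _) (by positivity))
              (mul_le_mul (hC _) hmin (abs_nonneg _) hC0) (by positivity) (by positivity)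
        _ = _ := by ring
  calc ε / (N + 1 : ℝ) * |_| ≤ ε / (N + 1 : ℝ) * ((r ^ 2)⁻¹ * (3 / (Real.pi * r ^ 3)) * C *
        collisionPairSum (Torus.geometry (Fin 3)) ε γ (Set.Icc 0 τ) fun _ _ _ => (1 : ℝ)) :=
        mul_le_mul_of_nonneg_left h (div_nonneg hε (by positivity))
    _ = _ := by ring

/-- **Sup bound of the marked window functional.** [folklore] -/
theorem abs_KwR_le (hγ : IsHardSphereTrajectory (Torus.geometry (Fin 3)) ε (N + 1) γ) (hε : 0 ≤ ε) (hr : 0 < r)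
    {Ξ : V3 × V3 × V3 → ℝ} {C : ℝ} (hC : ∀ p, |Ξ p| ≤ C) :
    |KwR ε r τ Ξ γ t₀ x₀| ≤ (r ^ 2)⁻¹ * (3 / (Real.pi * r ^ 3)) * C *
      (ε / (N + 1 : ℝ) * collisionPairSum (Torus.geometry (Fin 3)) ε γ (Set.Icc 0 τ) fun _ _ _ => (1 : ℝ)) := by
  have hfin := finite_collisionTimes_Icc hγ τ
  have hC0 : 0 ≤ C := (abs_nonneg _).trans (hC 0)
  rw [KwR_eq hγ, abs_mul, abs_of_nonneg (div_nonneg hε (by positivity))]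
  have h := abs_collisionPairSum_le hfin (K := (r ^ 2)⁻¹ * (3 / (Real.pi * r ^ 3)) * C) (g := fun s i j =>
      btent r (s - t₀) * cone r (γ s i).1 x₀ *
        Ξ (ε⁻¹ • (Torus.geometry (Fin 3)).sepVec (γ s i).1 (γ s j).1, (pvW (γ s) i j).1, (pvW (γ s) i j).2))
    fun t _ p _ => by
      rw [abs_mul, abs_mul, abs_of_nonneg (btent_nonneg _ _), abs_of_nonneg (cone_nonneg hr _ _)]
      exact mul_le_mul (mul_le_mul (btent_le _ _) (cone_le_peak hr _ _) (cone_nonneg hr _ _) (by positivity))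
        (hC _) (abs_nonneg _) (by positivity)
  calc ε / (N + 1 : ℝ) * |_| ≤ ε / (N + 1 : ℝ) * ((r ^ 2)⁻¹ * (3 / (Real.pi * r ^ 3)) * C *
        collisionPairSum (Torus.geometry (Fin 3)) ε γ (Set.Icc 0 τ) fun _ _ _ => (1 : ℝ)) :=
        mul_le_mul_of_nonneg_left h (div_nonneg hε (by positivity))
    _ = _ := by ring

/-- The two-time functional in closed (double-sum) form. [folklore] -/
theorem BwW_eq_double (Ξ : V3 × V3 × V3 → ℝ) :
    BwW r τ Ξ γ t₀ x₀ = ∫ s₁ in Set.Icc (0 : ℝ) τ, ∫ s₂ in Set.Icc (0 : ℝ) τ, btent r (s₁ - t₀) * btent r (s₂ - t₀) *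
      (((N + 1 : ℕ) : ℝ)⁻¹ * ((N + 1 : ℕ) : ℝ)⁻¹ *
        ∑ i, ∑ k, cone r (γ s₁ i).1 x₀ * cone r (γ s₂ k).1 x₀ * sphereMark Ξ (γ s₁ i).2 (γ s₂ k).2) := by
  unfold BwW
  refine integral_congr_ae (Eventually.of_forall fun s₁ => integral_congr_ae (Eventually.of_forall fun s₂ => ?_))
  show btent r (s₁ - t₀) * btent r (s₂ - t₀) *
    ∫ p, cone r p.1.1 x₀ * cone r p.2.1 x₀ * sphereMark Ξ p.1.2 p.2.2
      ∂((empiricalMeasure (γ s₁)).prod (empiricalMeasure (γ s₂))) = _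
  rw [integral_prod_empiricalMeasure₂]

/-- The double-sum integrand of the two-time functional is bounded along a path with velocities `≤ R`. [folklore] -/
theorem abs_BwW_integrand_le (hr : 0 < r) {R : ℝ} (hR : ∀ s k, ‖(γ s k).2‖ ≤ R) {Ξ : V3 × V3 × V3 → ℝ} {C : ℝ}
    (hC : ∀ p, |Ξ p| ≤ C) (s₁ s₂ : ℝ) :
    |btent r (s₁ - t₀) * btent r (s₂ - t₀) * (((N + 1 : ℕ) : ℝ)⁻¹ * ((N + 1 : ℕ) : ℝ)⁻¹ *
        ∑ i, ∑ k, cone r (γ s₁ i).1 x₀ * cone r (γ s₂ k).1 x₀ * sphereMark Ξ (γ s₁ i).2 (γ s₂ k).2)| ≤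
      (r ^ 2)⁻¹ * (r ^ 2)⁻¹ * ((3 / (Real.pi * r ^ 3)) * (3 / (Real.pi * r ^ 3)) *
        (sphereMeasure.real (Set.univ : Set (Metric.sphere (0 : V3) 1)) * (C * (R + R)))) := by
  have hC0 : 0 ≤ C := (abs_nonneg _).trans (hC 0)
  have hR0 : 0 ≤ R := (norm_nonneg _).trans (hR 0 0)
  set S := sphereMeasure.real (Set.univ : Set (Metric.sphere (0 : V3) 1)) with hS
  have hS0 : 0 ≤ S := measureReal_nonneg
  have hΘ : ∀ i k, |sphereMark Ξ (γ s₁ i).2 (γ s₂ k).2| ≤ S * (C * (R + R)) := fun i k =>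
    (abs_sphereMark_le hC _ _).trans (mul_le_mul_of_nonneg_left
      (mul_le_mul_of_nonneg_left (add_le_add (hR _ _) (hR _ _)) hC0) hS0)
  have hsum : |∑ i, ∑ k, cone r (γ s₁ i).1 x₀ * cone r (γ s₂ k).1 x₀ * sphereMark Ξ (γ s₁ i).2 (γ s₂ k).2| ≤
      ∑ _i : Fin (N + 1), ∑ _k : Fin (N + 1), (3 / (Real.pi * r ^ 3)) * (3 / (Real.pi * r ^ 3)) * (S * (C * (R + R))) := by
    refine (Finset.abs_sum_le_sum_abs _ _).trans (Finset.sum_le_sum fun i _ =>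
      (Finset.abs_sum_le_sum_abs _ _).trans (Finset.sum_le_sum fun k _ => ?_))
    rw [abs_mul, abs_mul, abs_of_nonneg (cone_nonneg hr _ _), abs_of_nonneg (cone_nonneg hr _ _)]
    exact mul_le_mul (mul_le_mul (cone_le_peak hr _ _) (cone_le_peak hr _ _) (cone_nonneg hr _ _) (by positivity))
      (hΘ i k) (abs_nonneg _) (by positivity)
  rw [Finset.sum_const, Finset.card_univ, Fintype.card_fin, nsmul_eq_mul] at hsum
  simp only [Finset.sum_const, Finset.card_univ, Fintype.card_fin, nsmul_eq_mul] at hsum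
  rw [abs_mul, abs_mul, abs_mul, abs_of_nonneg (btent_nonneg _ _), abs_of_nonneg (btent_nonneg _ _),
    abs_of_nonneg (by positivity : (0 : ℝ) ≤ ((N + 1 : ℕ) : ℝ)⁻¹ * ((N + 1 : ℕ) : ℝ)⁻¹)]
  have hN : (0 : ℝ) < ((N + 1 : ℕ) : ℝ) := by positivity
  calc btent r (s₁ - t₀) * btent r (s₂ - t₀) * (((N + 1 : ℕ) : ℝ)⁻¹ * ((N + 1 : ℕ) : ℝ)⁻¹ * |_|)
      ≤ (r ^ 2)⁻¹ * (r ^ 2)⁻¹ * (((N + 1 : ℕ) : ℝ)⁻¹ * ((N + 1 : ℕ) : ℝ)⁻¹ *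
          (((N + 1 : ℕ) : ℝ) * (((N + 1 : ℕ) : ℝ) * ((3 / (Real.pi * r ^ 3)) * (3 / (Real.pi * r ^ 3)) *
            (S * (C * (R + R))))))) :=
        mul_le_mul (mul_le_mul (btent_le _ _) (btent_le _ _) (btent_nonneg _ _) (by positivity))
          (mul_le_mul_of_nonneg_left hsum (by positivity)) (by positivity) (by positivity)
    _ = _ := by field_simp

/-- **Sup bound of the two-time functional** (`0 ≤ τ`). [folklore] -/
theorem abs_BwW_le (hr : 0 < r) (hτ : 0 ≤ τ) {R : ℝ} (hR : ∀ s k, ‖(γ s k).2‖ ≤ R) {Ξ : V3 × V3 × V3 → ℝ} {C : ℝ}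
    (hC : ∀ p, |Ξ p| ≤ C) :
    |BwW r τ Ξ γ t₀ x₀| ≤ τ * (τ * ((r ^ 2)⁻¹ * (r ^ 2)⁻¹ * ((3 / (Real.pi * r ^ 3)) * (3 / (Real.pi * r ^ 3)) *
        (sphereMeasure.real (Set.univ : Set (Metric.sphere (0 : V3) 1)) * (C * (R + R)))))) := by
  rw [BwW_eq_double]
  have hvol : (volume (Set.Icc (0 : ℝ) τ)).toReal = τ := by
    rw [Real.volume_Icc, ENNReal.toReal_ofReal (by linarith), sub_zero]
  set K := (r ^ 2)⁻¹ * (r ^ 2)⁻¹ * ((3 / (Real.pi * r ^ 3)) * (3 / (Real.pi * r ^ 3)) *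
    (sphereMeasure.real (Set.univ : Set (Metric.sphere (0 : V3) 1)) * (C * (R + R)))) with hK
  have hin : ∀ s₁, |∫ s₂ in Set.Icc (0 : ℝ) τ, btent r (s₁ - t₀) * btent r (s₂ - t₀) *
      (((N + 1 : ℕ) : ℝ)⁻¹ * ((N + 1 : ℕ) : ℝ)⁻¹ *
        ∑ i, ∑ k, cone r (γ s₁ i).1 x₀ * cone r (γ s₂ k).1 x₀ * sphereMark Ξ (γ s₁ i).2 (γ s₂ k).2)| ≤ τ * K := by
    intro s₁
    have hb : ∀ s₂ ∈ Set.Icc (0 : ℝ) τ, ‖btent r (s₁ - t₀) * btent r (s₂ - t₀) *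
        (((N + 1 : ℕ) : ℝ)⁻¹ * ((N + 1 : ℕ) : ℝ)⁻¹ *
          ∑ i, ∑ k, cone r (γ s₁ i).1 x₀ * cone r (γ s₂ k).1 x₀ * sphereMark Ξ (γ s₁ i).2 (γ s₂ k).2)‖ ≤ K :=
      fun s₂ _ => by rw [Real.norm_eq_abs, hK]; exact abs_BwW_integrand_le (t₀ := t₀) (x₀ := x₀) hr hR hC s₁ s₂
    have h := norm_setIntegral_le_of_norm_le_const (s := Set.Icc (0 : ℝ) τ)
      (by rw [Real.volume_Icc]; exact ENNReal.ofReal_lt_top) hb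
    rw [Real.norm_eq_abs, measureReal_def, hvol] at h
    linarith
  have hb' : ∀ s₁ ∈ Set.Icc (0 : ℝ) τ, ‖∫ s₂ in Set.Icc (0 : ℝ) τ, btent r (s₁ - t₀) * btent r (s₂ - t₀) *
      (((N + 1 : ℕ) : ℝ)⁻¹ * ((N + 1 : ℕ) : ℝ)⁻¹ *
        ∑ i, ∑ k, cone r (γ s₁ i).1 x₀ * cone r (γ s₂ k).1 x₀ * sphereMark Ξ (γ s₁ i).2 (γ s₂ k).2)‖ ≤ τ * K :=
    fun s₁ _ => by rw [Real.norm_eq_abs]; exact hin s₁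
  have h := norm_setIntegral_le_of_norm_le_const (s := Set.Icc (0 : ℝ) τ)
    (by rw [Real.volume_Icc]; exact ENNReal.ofReal_lt_top) hb'
  rw [Real.norm_eq_abs, measureReal_def, hvol] at h
  linarith

end Bounds

/-- **Registered sub-goal `stub_wciPairSumSup` (helper G of `stub_windowCovarianceIsotropy`): a collision pair sum
with summand bounded by `K` on the contact triples is bounded by `K` times the number of ordered contact events.**
[folklore] -/
theorem stub_wciPairSumSup : ∀ {d : Type*} [Fintype d] {X : Type*} {n : ℕ} {G : Geometry d X} {ε : ℝ} {γ : ℝ → Config n d X} {S : Set ℝ}, (collisionTimes G ε γ ∩ S).Finite → ∀ {g : ℝ → Fin n → Fin n → ℝ} {K : ℝ}, (∀ t ∈ collisionTimes G ε γ ∩ S, ∀ p ∈ contactPairs G ε (γ t), |g t p.1 p.2| ≤ K) → |collisionPairSum G ε γ S g| ≤ K * collisionPairSum G ε γ S fun _ _ _ => (1 : ℝ) :=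
  fun hfin _ _ h => abs_collisionPairSum_le hfin h

end Summit.AtomisticToContinuum.HydrodynamicLimit.Theorems.ParityBandClosureWindowCovariance

end
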